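import Mathlib
import Summits.Ventures.PercRepro.TriangleCapStarFamilyTwoOffDeg
import Summits.Ventures.PercRepro.TriangleCapStarFamilyWitness

/-!
# PercRepro — THE STAR FAMILY WITH TWO SHORT CENTRE ROWS: THE WITNESS (p3, gen 57; part 343)

The graph `HSF2` of part 341 on `ℓ + 1 + (s − t)` vertices, `t = Rc + a (D − 1) + Q D + a`, is a graph of the band
(triangle-free, `s` edges, `w` of degree `s − t`, every off-degree `≤ D`, a non-neighbour of off-degree exactly `D`)
with `a` inside edges and the deficiency
`Σ_{v ≠ w} c(v) (D − c(v)) = (Rc + a)(D − Rc − a) + (D − sh0) sh0 + (D − sh1) sh1` (the centre and the two short rows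
are the only vertices with `0 < c < D`), so by the deficiency identity of part 282 its band value is
`2 j + 2 t (D − 1) = t (t − 1) + 2 a + (Rc + a)(D − Rc − a) + (D − sh0) sh0 + (D − sh1) sh1`
(`starFamilyTwoWitness`).  Part 344 picks the parameters one below the threshold of the upper regime.
Axioms: standard.
-/
namespace PercRepro

namespace TriangleCap

namespace C047

open Finset

/-- The block sizes are at most `D` (and at most `D − 1` on the centre rows). -/
theorem kSF2_le_D (D a Rc sh0 sh1 ρ : ℕ) : kSF2 D a Rc sh0 sh1 ρ ≤ D := by
  unfold kSF2
  split_ifs <;> omega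

/-- The block size of a centre row other than the first two is `D − 1`. -/
theorem kSF2_centre_eq (D a Rc sh0 sh1 ρ : ℕ) (h2 : 2 ≤ ρ) (hρ : ρ < Rc) : kSF2 D a Rc sh0 sh1 ρ = D - 1 := by
  unfold kSF2
  rw [if_neg (by omega), if_neg (by omega), if_pos hρ]

/-- The block size of an outer row is `D − a`. -/
theorem kSF2_outer_eq (D a Rc sh0 sh1 ρ : ℕ) (hRc : 2 ≤ Rc) (h1 : Rc ≤ ρ) (h2 : ρ < Rc + (D - 1)) :
    kSF2 D a Rc sh0 sh1 ρ = D - a := by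
  unfold kSF2
  rw [if_neg (by omega), if_neg (by omega), if_neg (by omega), if_pos h2]

/-- Every off-degree of the star family is at most `D`. -/
theorem offSF2_le (ℓ D a Rc sh0 sh1 E Q v : ℕ) (_ha : 1 ≤ a) (hRc : 2 ≤ Rc) (haR : a + Rc ≤ D)
    (hsh0 : sh0 + 1 ≤ D) (hsh1 : sh1 + 1 ≤ D) : offSF2 ℓ D a Rc sh0 sh1 E Q v ≤ D := by
  have hk := kSF2_le_D D a Rc sh0 sh1 (v - (ℓ + 1))
  unfold offSF2
  split_ifs <;> first
    | omega
    | (rw [kSF2_outer_eq D a Rc sh0 sh1 _ hRc (by omega) (by omega)]; omega)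
    | (rcases Nat.lt_or_ge (v - (ℓ + 1)) 2 with hρ | hρ
       · unfold kSF2
         split_ifs <;> omega
       · rw [kSF2_centre_eq D a Rc sh0 sh1 _ hρ (by omega)]
         omega)

/-- The special `1` has off-degree `D`. -/
theorem offSF2_one (ℓ D a Rc sh0 sh1 E Q : ℕ) (ha : 1 ≤ a) : offSF2 ℓ D a Rc sh0 sh1 E Q 1 = D := by
  unfold offSF2
  rw [if_neg (show ¬ (1 = 0) by omega), if_pos ha]

/-- The centre has off-degree `Rc + a`. -/
theorem offSF2_centre (ℓ D a Rc sh0 sh1 E Q : ℕ) (ha : 1 ≤ a) : offSF2 ℓ D a Rc sh0 sh1 E Q (a + Q + 1) = Rc + a := by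
  unfold offSF2
  rw [if_neg (show ¬ (a + Q + 1 = 0) by omega), if_neg (show ¬ (a + Q + 1 ≤ a) by omega),
    if_neg (show ¬ (a + Q + 1 ≤ a + Q) by omega), if_pos rfl]

/-- The first centre row has off-degree `D − sh0`. -/
theorem offSF2_first_row (ℓ D a Rc sh0 sh1 E Q : ℕ) (hRc : 2 ≤ Rc) (hsh0 : sh0 + 1 ≤ D) (hℓ : a + Q + 1 ≤ ℓ) :
    offSF2 ℓ D a Rc sh0 sh1 E Q (ℓ + 1) = D - sh0 := by
  unfold offSF2
  rw [if_neg (show ¬ (ℓ + 1 = 0) by omega), if_neg (show ¬ (ℓ + 1 ≤ a) by omega),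
    if_neg (show ¬ (ℓ + 1 ≤ a + Q) by omega), if_neg (show ¬ (ℓ + 1 = a + Q + 1) by omega),
    if_neg (show ¬ (ℓ + 1 ≤ ℓ) by omega), if_pos (show ℓ + 1 < ℓ + 1 + Rc by omega), Nat.sub_self]
  unfold kSF2
  rw [if_pos rfl]
  omega

/-- The second centre row has off-degree `D − sh1`. -/
theorem offSF2_second_row (ℓ D a Rc sh0 sh1 E Q : ℕ) (hRc : 2 ≤ Rc) (hsh1 : sh1 + 1 ≤ D) (hℓ : a + Q + 1 ≤ ℓ) :
    offSF2 ℓ D a Rc sh0 sh1 E Q (ℓ + 2) = D - sh1 := by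
  unfold offSF2
  rw [if_neg (show ¬ (ℓ + 2 = 0) by omega), if_neg (show ¬ (ℓ + 2 ≤ a) by omega),
    if_neg (show ¬ (ℓ + 2 ≤ a + Q) by omega), if_neg (show ¬ (ℓ + 2 = a + Q + 1) by omega),
    if_neg (show ¬ (ℓ + 2 ≤ ℓ) by omega), if_pos (show ℓ + 2 < ℓ + 1 + Rc by omega),
    show ℓ + 2 - (ℓ + 1) = 1 by omega]
  unfold kSF2
  rw [if_neg (show ¬ (1 = 0) by omega), if_pos rfl]
  omega

/-- Every vertex other than `0`, the centre and the first two centre rows has off-degree `0` or `D`. -/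
theorem offSF2_zero_or (ℓ D a Rc sh0 sh1 E Q v : ℕ) (_ha : 1 ≤ a) (hRc : 2 ≤ Rc) (haR : a + Rc ≤ D)
    (hsh0 : sh0 + 1 ≤ D) (_hsh1 : sh1 + 1 ≤ D) (hvc : v ≠ a + Q + 1) (hv1 : v ≠ ℓ + 1) (hv2 : v ≠ ℓ + 2) :
    offSF2 ℓ D a Rc sh0 sh1 E Q v = 0 ∨ offSF2 ℓ D a Rc sh0 sh1 E Q v = D := by
  unfold offSF2
  split_ifs <;> first
    | omega
    | (rw [kSF2_centre_eq D a Rc sh0 sh1 _ (by omega) (by omega)]; omega)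
    | (rw [kSF2_outer_eq D a Rc sh0 sh1 _ hRc (by omega) (by omega)]; omega)

/-- **THE DEFICIENCY OF THE TWO-SHORT STAR FAMILY:**
`Σ_{v ≠ w} c(v) (D − c(v)) = (Rc + a)(D − Rc − a) + (D − sh0) sh0 + (D − sh1) sh1`. -/
theorem sum_deficiency_HSF2 (s ℓ t D a Rc sh0 sh1 E Q : ℕ) (ha : 1 ≤ a) (hRc : 2 ≤ Rc) (haR : a + Rc ≤ D)
    (hsh0 : sh0 + 1 ≤ D) (hsh1 : sh1 + 1 ≤ D) (hQ : 1 ≤ Q) (hQ1 : D ≤ Q + 1) (hQE : 1 ≤ E → D ≤ Q)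
    (hinc : Rc * (D - 1) + (D - 1) * (D - a) + E * D = Q * D + (sh0 + sh1)) (hℓ : a + Q + 1 ≤ ℓ)
    (hN : Rc + (D - 1) + E ≤ s - t) :
    ∑ v ∈ univ.erase (fin' (nSF s ℓ t) (nSF_pos s ℓ t) 0),
      offDeg (HSF2 s ℓ t D a Rc sh0 sh1 E Q) (fin' (nSF s ℓ t) (nSF_pos s ℓ t) 0) v *
        (D - offDeg (HSF2 s ℓ t D a Rc sh0 sh1 E Q) (fin' (nSF s ℓ t) (nSF_pos s ℓ t) 0) v) =
      (Rc + a) * (D - (Rc + a)) + ((D - sh0) * sh0 + (D - sh1) * sh1) := by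
  have hC : a + Q + 1 < nSF s ℓ t := by
    unfold nSF
    omega
  have h1 : ℓ + 1 < nSF s ℓ t := by
    unfold nSF
    omega
  have h2 : ℓ + 2 < nSF s ℓ t := by
    unfold nSF
    omega
  have hne : fin' (nSF s ℓ t) (nSF_pos s ℓ t) (a + Q + 1) ≠ fin' (nSF s ℓ t) (nSF_pos s ℓ t) (ℓ + 1) :=
    fin'_ne' _ _ _ _ hC h1 (by omega)
  have hr2 : fin' (nSF s ℓ t) (nSF_pos s ℓ t) (ℓ + 2) ∈ univ.erase (fin' (nSF s ℓ t) (nSF_pos s ℓ t) 0) :=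
    mem_erase.mpr ⟨fin'_ne' _ _ _ _ h2 (nSF_pos s ℓ t) (by omega), mem_univ _⟩
  rw [← sum_erase_add _ _ hr2]
  have h₀ : ∀ v ∈ (univ.erase (fin' (nSF s ℓ t) (nSF_pos s ℓ t) 0)).erase (fin' (nSF s ℓ t) (nSF_pos s ℓ t) (ℓ + 2)),
      v ≠ fin' (nSF s ℓ t) (nSF_pos s ℓ t) (a + Q + 1) ∧ v ≠ fin' (nSF s ℓ t) (nSF_pos s ℓ t) (ℓ + 1) →
      offDeg (HSF2 s ℓ t D a Rc sh0 sh1 E Q) (fin' (nSF s ℓ t) (nSF_pos s ℓ t) 0) v *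
        (D - offDeg (HSF2 s ℓ t D a Rc sh0 sh1 E Q) (fin' (nSF s ℓ t) (nSF_pos s ℓ t) 0) v) = 0 := by
    intro v hv hvne
    rw [mem_erase, mem_erase] at hv
    have hvv : v = fin' (nSF s ℓ t) (nSF_pos s ℓ t) v.val := Fin.ext (by rw [fin'_val _ _ _ v.isLt])
    have hvc : v.val ≠ a + Q + 1 := by
      intro h
      apply hvne.1
      rw [hvv, h]
    have hv1 : v.val ≠ ℓ + 1 := by
      intro h
      apply hvne.2
      rw [hvv, h]
    have hv2 : v.val ≠ ℓ + 2 := by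
      intro h
      apply hv.1
      rw [hvv, h]
    rw [hvv, offDeg_HSF2 s ℓ t D a Rc sh0 sh1 E Q ha hRc hsh0 hsh1 hQ hQ1 hQE hinc hℓ hN v.val v.isLt]
    rcases offSF2_zero_or ℓ D a Rc sh0 sh1 E Q v.val ha hRc haR hsh0 hsh1 hvc hv1 hv2 with h | h
    · rw [h, zero_mul]
    · rw [h, Nat.sub_self, mul_zero]
  rw [sum_eq_add _ _ hne h₀
    (fun h => absurd (mem_erase.mpr ⟨fin'_ne' _ _ _ _ hC h2 (by omega),
      mem_erase.mpr ⟨fin'_ne' _ _ _ _ hC (nSF_pos s ℓ t) (by omega), mem_univ _⟩⟩) h)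
    (fun h => absurd (mem_erase.mpr ⟨fin'_ne' _ _ _ _ h1 h2 (by omega),
      mem_erase.mpr ⟨fin'_ne' _ _ _ _ h1 (nSF_pos s ℓ t) (by omega), mem_univ _⟩⟩) h),
    offDeg_HSF2 s ℓ t D a Rc sh0 sh1 E Q ha hRc hsh0 hsh1 hQ hQ1 hQE hinc hℓ hN (a + Q + 1) hC,
    offDeg_HSF2 s ℓ t D a Rc sh0 sh1 E Q ha hRc hsh0 hsh1 hQ hQ1 hQE hinc hℓ hN (ℓ + 1) h1,
    offDeg_HSF2 s ℓ t D a Rc sh0 sh1 E Q ha hRc hsh0 hsh1 hQ hQ1 hQE hinc hℓ hN (ℓ + 2) h2,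
    offSF2_centre ℓ D a Rc sh0 sh1 E Q ha, offSF2_first_row ℓ D a Rc sh0 sh1 E Q hRc hsh0 hℓ,
    offSF2_second_row ℓ D a Rc sh0 sh1 E Q hRc hsh1 hℓ]
  have e0 : D - (D - sh0) = sh0 := by omega
  have e1 : D - (D - sh1) = sh1 := by omega
  rw [e0, e1]
  ring

/-- **THE ATTACHMENT OF THE STAR FAMILY:** every cross pair ends at a leaf, the inside edges at none:
`attach = Rc + a (D − 1) + Q D`. -/
theorem attach_HSF2 (s ℓ t D a Rc sh0 sh1 E Q : ℕ) (ht : t = Rc + a * (D - 1) + Q * D + a) (ha : 1 ≤ a)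
    (hRc : 2 ≤ Rc) (hsh0 : sh0 + 1 ≤ D) (hsh1 : sh1 + 1 ≤ D) (hQ : 1 ≤ Q) (hQ1 : D ≤ Q + 1) (hQE : 1 ≤ E → D ≤ Q)
    (hinc : Rc * (D - 1) + (D - 1) * (D - a) + E * D = Q * D + (sh0 + sh1)) (hℓ : a + Q + 1 ≤ ℓ)
    (hN : Rc + (D - 1) + E ≤ s - t) (hs : 2 * t ≤ s) :
    attach (HSF2 s ℓ t D a Rc sh0 sh1 E Q) (fin' (nSF s ℓ t) (nSF_pos s ℓ t) 0) = Rc + a * (D - 1) + Q * D := by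
  have hg := goodEnds_SF2 (nSF s ℓ t) ℓ D a Rc sh0 sh1 E Q ha hRc hsh0 hsh1 hQ hQ1 hQE hinc hℓ (by unfold nSF; omega)
  have hatt := attach_genWitness (nSF s ℓ t) (ℓ + 1) (s - a) (Rc + a * (D - 1) + Q * D) (nSF_pos s ℓ t)
    (lfSF D a Rc Q) (rfSF2 ℓ D a Rc sh0 sh1 E) hg (by omega) (by unfold nSF; omega)
  have hall : ((range (Rc + a * (D - 1) + Q * D)).filter
      (fun i => rfSF2 ℓ D a Rc sh0 sh1 E i < ℓ + 1 + (s - a - (Rc + a * (D - 1) + Q * D)))).card =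
      Rc + a * (D - 1) + Q * D := by
    rw [filter_true_of_mem (fun i hi => by
      have := rfSF2_bounds ℓ D a Rc sh0 sh1 E Q i ha hRc hsh0 hsh1 hinc (mem_range.mp hi)
      omega), card_range]
  have hsame : attach (HSF2 s ℓ t D a Rc sh0 sh1 E Q) (fin' (nSF s ℓ t) (nSF_pos s ℓ t) 0) =
      attach (H0SF2 s ℓ t D a Rc sh0 sh1 E Q) (fin' (nSF s ℓ t) (nSF_pos s ℓ t) 0) := by
    unfold attach
    apply sum_congr
    · apply filter_congr
      intro v _
      exact addEdges_adj_of_notMem _ _ _ (SSF_zero s ℓ t a Q hℓ) v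
    intro v hv
    rw [mem_filter] at hv
    rw [offDeg_addEdges _ _ (SSF_nondiag s ℓ t a Q hℓ) (SSF2_new s ℓ t D a Rc sh0 sh1 E Q hℓ) _
      (SSF_zero s ℓ t a Q hℓ) v]
    have hv' : ℓ + 1 ≤ v.val := by
      by_contra hcon
      rw [not_le] at hcon
      exact not_adj_H0SF2_left s ℓ t D a Rc sh0 sh1 E Q _ v (by rw [fin'_val _ _ 0 (nSF_pos s ℓ t)]; omega) hcon
        hv.2
    have hzero : ((SSF s ℓ t a Q).filter (fun e => v ∈ e)).card = 0 := by
      rw [card_eq_zero, filter_eq_empty_iff]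
      intro e he hve
      have := SSF_ends s ℓ t a Q hℓ e he v hve
      omega
    rw [hzero, add_zero]
  rw [hsame, hatt, hall]

/-- **THE TWO-SHORT STAR FAMILY WITNESS:** for `1 ≤ a`, `2 ≤ Rc`, `a + Rc ≤ D`, `sh0, sh1 < D`, `D − 1 ≤ Q` (and
`D ≤ Q` when there are extra rows), the incidence identity `Rc (D − 1) + (D − 1)(D − a) + E D = Q D + sh0 + sh1`,
`a + Q + 1 ≤ ℓ` non-neighbours and `2 t ≤ s` with `t = Rc + a (D − 1) + Q D + a`: a triangle-free graph on
`ℓ + 1 + (s − t)` vertices with `s` edges, a vertex `w` of degree `s − t`, every off-degree `≤ D`, a non-neighbour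
of off-degree exactly `D`, and the band value
`2 j + 2 t (D − 1) = t (t − 1) + 2 a + (Rc + a)(D − Rc − a) + (D − sh0) sh0 + (D − sh1) sh1`. -/
theorem starFamilyTwoWitness (s ℓ t D a Rc sh0 sh1 E Q : ℕ) (ht : t = Rc + a * (D - 1) + Q * D + a) (ha : 1 ≤ a)
    (hRc : 2 ≤ Rc) (haR : a + Rc ≤ D) (hsh0 : sh0 + 1 ≤ D) (hsh1 : sh1 + 1 ≤ D) (hQ : 1 ≤ Q) (hQ1 : D ≤ Q + 1)
    (hQE : 1 ≤ E → D ≤ Q) (hinc : Rc * (D - 1) + (D - 1) * (D - a) + E * D = Q * D + (sh0 + sh1))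
    (hℓ : a + Q + 1 ≤ ℓ) (hs : 2 * t ≤ s) :
    ∃ (H : SimpleGraph (Fin (ℓ + 1 + (s - t)))) (_ : DecidableRel H.Adj), H.CliqueFree 3 ∧
      H.edgeFinset.card = s ∧ ∃ w, deg H w + t = s ∧ (∀ v, offDeg H w v ≤ D) ∧
        (∃ x, ¬ H.Adj w x ∧ offDeg H w x = D) ∧
        ∃ j, ∑ v, deg H v * deg H v + 2 * (t * (s - t - 1)) + 2 * j = s * (s + 1) ∧
          2 * j + 2 * (t * (D - 1)) =
            t * (t - 1) + 2 * a + ((Rc + a) * (D - (Rc + a)) + ((D - sh0) * sh0 + (D - sh1) * sh1)) := by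
  -- the rows fit among the leaves: `E ≤ Q` by the incidence identity, so `Rc + (D − 1) + E ≤ t ≤ s − t`
  have hEQ : E ≤ Q := by
    have h1 : E * D ≤ Q * D := by
      have := Nat.mul_le_mul_right (D - 1) hRc
      omega
    exact Nat.le_of_mul_le_mul_right h1 (by omega)
  have hN : Rc + (D - 1) + E ≤ s - t := by
    have h1 : D - 1 ≤ a * (D - 1) := Nat.le_mul_of_pos_left (D - 1) ha
    have h2 : Q ≤ Q * D := Nat.le_mul_of_pos_right Q (by omega)
    omega
  have hD0 : 0 < D := by omega
  have hfree := cliqueFree_HSF2 s ℓ t D a Rc sh0 sh1 E Q ha hRc hsh0 hsh1 hQ hQ1 hQE hinc hℓ hN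
  have hcard := card_edges_HSF2 s ℓ t D a Rc sh0 sh1 E Q ht ha hRc hsh0 hsh1 hQ hQ1 hQE hinc hℓ hN hs
  have hdeg := deg_HSF2_zero s ℓ t D a Rc sh0 sh1 E Q ht ha hRc hsh0 hsh1 hQ hQ1 hQE hinc hℓ hN hs
  have hDle : ∀ v, offDeg (HSF2 s ℓ t D a Rc sh0 sh1 E Q) (fin' (nSF s ℓ t) (nSF_pos s ℓ t) 0) v ≤ D := by
    intro v
    have hvv : v = fin' (nSF s ℓ t) (nSF_pos s ℓ t) v.val := Fin.ext (by rw [fin'_val _ _ _ v.isLt])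
    rw [hvv, offDeg_HSF2 s ℓ t D a Rc sh0 sh1 E Q ha hRc hsh0 hsh1 hQ hQ1 hQE hinc hℓ hN v.val v.isLt]
    exact offSF2_le ℓ D a Rc sh0 sh1 E Q v.val ha hRc haR hsh0 hsh1
  have ht1 : 1 ≤ t := by omega
  have hw1 : 1 ≤ deg (HSF2 s ℓ t D a Rc sh0 sh1 E Q) (fin' (nSF s ℓ t) (nSF_pos s ℓ t) 0) := by
    rw [hdeg]
    omega
  obtain ⟨j, -, hj⟩ := sum_deg_sq_layer (HSF2 s ℓ t D a Rc sh0 sh1 E Q) hfree (fin' (nSF s ℓ t) (nSF_pos s ℓ t) 0) hw1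
  have hoff : (offEdges (HSF2 s ℓ t D a Rc sh0 sh1 E Q) (fin' (nSF s ℓ t) (nSF_pos s ℓ t) 0)).card = t := by
    have := card_offEdges_add_deg (HSF2 s ℓ t D a Rc sh0 sh1 E Q) (fin' (nSF s ℓ t) (nSF_pos s ℓ t) 0)
    rw [hdeg, hcard] at this
    omega
  rw [hoff, hdeg, hcard] at hj
  refine ⟨HSF2 s ℓ t D a Rc sh0 sh1 E Q, inferInstance, hfree, hcard, fin' (nSF s ℓ t) (nSF_pos s ℓ t) 0, ?_, hDle,
    ?_, j, hj, ?_⟩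
  · rw [hdeg]
    omega
  · refine ⟨fin' (nSF s ℓ t) (nSF_pos s ℓ t) 1, ?_, ?_⟩
    · rw [addEdges_adj_of_notMem _ _ _ (SSF_zero s ℓ t a Q hℓ)]
      exact not_adj_genWitness_one (nSF s ℓ t) (ℓ + 1) (s - a) (Rc + a * (D - 1) + Q * D) (nSF_pos s ℓ t)
        (lfSF D a Rc Q) (rfSF2 ℓ D a Rc sh0 sh1 E) (by omega) (by unfold nSF; omega)
    · rw [offDeg_HSF2 s ℓ t D a Rc sh0 sh1 E Q ha hRc hsh0 hsh1 hQ hQ1 hQE hinc hℓ hN 1 (by unfold nSF; omega)]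
      exact offSF2_one ℓ D a Rc sh0 sh1 E Q ha
  · have hdef := deficiency_identity (HSF2 s ℓ t D a Rc sh0 sh1 E Q) hfree s t j D hcard
      (fin' (nSF s ℓ t) (nSF_pos s ℓ t) 0) (by rw [hdeg]; omega) hw1 hj hDle
    have hins : (insideEdges (HSF2 s ℓ t D a Rc sh0 sh1 E Q) (fin' (nSF s ℓ t) (nSF_pos s ℓ t) 0)).card = a := by
      have h1 := attach_add_card_inside (HSF2 s ℓ t D a Rc sh0 sh1 E Q) hfree (fin' (nSF s ℓ t) (nSF_pos s ℓ t) 0)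
      rw [attach_HSF2 s ℓ t D a Rc sh0 sh1 E Q ht ha hRc hsh0 hsh1 hQ hQ1 hQE hinc hℓ hN hs, hoff] at h1
      omega
    rw [hdef, hins, sum_deficiency_HSF2 s ℓ t D a Rc sh0 sh1 E Q ha hRc haR hsh0 hsh1 hQ hQ1 hQE hinc hℓ hN]

end C047

end TriangleCap

end PercRepro
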